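import Summits.QuantumFields.YangMills.Theorems.BalabanUVNodesN18U3TowerGuards
import Literature.MathematicalPhysics.QuantumFieldTheory.Balaban1983to89.Node00.U3OfKernels

/-!
# BalabanUVNodes ∕ node N18 = NE5 — THE GUARD `SensitiveOnBoxes` AT node00-def-W1's KERNEL OBJECTS OF RECORD (`Node00/U3OfKernels`, W1-19 p590183): the
# POSITIVE twin of the K3⁷ v2 skeleton's negative controls — at every datum whose β₁₃ is NOT boxwise constant, the objects of record PASS the node-U3 guard
# (plan g80 WORDS-1a (c)); the blind direction; the kernel-level reading of the guard; level-freeness of every fixed-carrier bundle; the pin form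

Cell `pub-ymgap`, width seat `pub-ymgap-dag-n18-w2` (HUMAN RULING D-0149; plan g80 «w2 take (a), then (c)»; (c) = «a `KeyedSensitive` INHABITANT at W1-19's U3 term-family
objects once they land» — W1-19 LANDED 00:39Z).  `--supports stmt-QuantumFields-20544` (K3⁷) AS A HELPER — count-neutral; PROOF lane (0 `def`).

THE POINT.  W1-19's objects of record `U3OfKernels.objectsOfRecord₁₃ F N θ ℓ` store, on ONE background-free carrier `(k, μ, ν, z)`, the limiting (1.21) kernels of the merged
term of record; `RepresentsA∕B … θ.γ (betaOfRecord₁₃ F N θ)` hold there BY CONSTRUCTION (`representsA_objectsOfRecord₁₃`, no hypothesis).  Hence, by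
`U3Guards.sensitiveOnBoxes_of_representsA` (p584126 §2): the objects of record are COUPLING-SENSITIVE OVER THE RECORD's BOXES — the guard the v2 stub 1 conjoins
(`KeyedSensitive`) — AS SOON AS `betaOfRecord₁₃ F N θ` is not boxwise constant on `]0, θ.γ]`; conversely kernels blind to the box histories force a boxwise-constant β₁₃.
Unconditionally the guard is NOT decidable here (`betaOfRecord₁₃` and the kernels are `limUnder` objects; non-degeneracy of β is NODE O's): this file is the exact
CONDITIONAL inhabitant, nothing more.

WHAT IS PROVED.
* §1 generic term family `ℰ` (`U3OfKernels.objects F ℰ ρ bV ℓ`, β-shape `betaOfMerged (betaMerged F ℰ ρ bV) β0 γ`): `boxwiseConstant_betaOfMerged_of_blindOnBoxes`,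
  ★ `sensitiveOnBoxes_objects_of_not_boxwiseConstant`, and the kernel-level reading `blindOnBoxes_objects_iff_kernels` (blind over the γ-boxes ⟺ at any two histories of one box
  ALL stored kernels `kernelA (extd v) j μ ν z` coincide).
* §2 at the Stage-13 record (`objectsOfRecord₁₃ F N θ ℓ`, β `betaOfRecord₁₃ F N θ`): `boxwiseConstant_betaOfRecord₁₃_of_blindOnBoxes`,
  ★★ `sensitiveOnBoxes_objectsOfRecord₁₃_of_not_boxwiseConstant`, the bundle form `sensitiveOnBoxes_u3OfRecord₁₃_objectsOfRecord₁₃` (any run-length index), and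
  `u3OfRecord₁₃_ofFixed_eq` (EVERY fixed-carrier reading — the kernel objects, the all-runs objects — gives a level-FREE bundle: a run-length selector is idle; `rfl`).
* §3 PIN FORM (the v2 `KeyedSensitive` conjunct at a reading pinned to the kernel objects of record): for `𝔯 : RateReading₁₃CoPH N` with
  `hpin : (𝔯.lit F θ hP g₀ os).u3 = objectsOfRecord₁₃ F N θ.toStage13Params (ℓ F θ)`, ★★ `sensitiveOnBoxes_rateCarriers_of_kernels_pin` — at every tuple whose β₁₃ is not
  boxwise constant, every run-length bundle of record passes the guard.

HONEST FRAMING.  Count-neutral helper; bookkeeping over W1-19's objects (term family `ℰ` of record = `mergedTermFamilyMatT …`, its VALUES residual in the sense of W1's honest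
limits block: `polLimit` total `limUnder`, infinite-volume kernels); nothing of Bałaban's asserted; NE5 ∕ NE9 ∕ (D4) NOT PRINTED for d = 4 ∕ NOT proved; β-non-degeneracy NOT
proved (displayed hypothesis); N18 NOT discharged; K3⁷ OPEN, not claimed; counts UNMOVED (typed 28∕28 · discharged 5∕27 (A 5∕28)).  One finite four-torus programme at fixed
`ε`; R4 closes the conditional finite-𝕋⁴ rung `BalabanLadder.UV` only — NOT ℝ⁴, NOT infinite volume, NOT OS, NOT a mass gap, NOT Clay.  No `def`, no `sorry`.
-/

set_option autoImplicit false

noncomputable section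

namespace YMDAG.N18.U3GuardsAtKernels

open Literature.MathematicalPhysics.QuantumFieldTheory.Balaban1983to89
open Literature.MathematicalPhysics.QuantumFieldTheory.Balaban1983to89.T4Continuum
open Literature.MathematicalPhysics.QuantumFieldTheory.Balaban1983to89.FlowStep (Box)
open Literature.MathematicalPhysics.QuantumFieldTheory.Balaban1983to89.T4FlagMemory (extd)
open Literature.MathematicalPhysics.QuantumFieldTheory.Balaban1983to89.T4OutputRate (Carriers Functional)
open Literature.MathematicalPhysics.QuantumFieldTheory.Balaban1983to89.Node00 (Stage13Params Stage13HParams TermFamily1 betaMerged betaOfMerged betaOfRecord₁₃ U3Objects₁₁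
  U3Letters₁₁)
open Literature.MathematicalPhysics.QuantumFieldTheory.Balaban1983to89.Node00.U3OfKernels (objects objectsOfRecord₁₃ kernelA representsA_objects representsA_objectsOfRecord₁₃)
open YMDAG.UVSplit
open YMDAG.N18.U3Guards

/-! ## §1 Generic term family: the guard at `U3OfKernels.objects` -/

section Generic

variable {𝔄 : Type*} [NormedRing 𝔄] [NormedAlgebra ℝ 𝔄] {V : Type*} [NormedAddCommGroup V] [NormedSpace ℝ V] {ι : Type*} [Fintype ι]
  (F : T4Family) (ℰ : TermFamily1 F 𝔄) (ρ : V →L[ℝ] 𝔄) (bV : Module.Basis ι ℝ V) (ℓ : U3Letters₁₁) (β0 : ℕ → ℝ) (γ : ℝ) (k : ℕ)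

/-- **KERNELS BLIND TO THE BOX HISTORIES FORCE A BOXWISE-CONSTANT β** (the β of the one-loop-split shape `betaOfMerged (betaMerged F ℰ ρ bV) β0 γ` is REPRESENTED on
the kernel objects — `U3OfKernels.representsA_objects` — so `U3Guards.boxwiseConstant_of_representsA_blind` applies). [folklore] -/
theorem boxwiseConstant_betaOfMerged_of_blindOnBoxes (h : BlindOnBoxes ((objects F ℰ ρ bV ℓ).EA k) γ) :
    BoxwiseConstant γ (betaOfMerged (betaMerged F ℰ ρ bV) β0 γ) :=
  boxwiseConstant_of_representsA_blind (representsA_objects F ℰ ρ bV ℓ β0 γ k) h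

/-- **★ THE KERNEL OBJECTS PASS THE GUARD WHENEVER THE β-SHAPE IS NOT BOXWISE CONSTANT** (`U3Guards.sensitiveOnBoxes_of_representsA`). [folklore] -/
theorem sensitiveOnBoxes_objects_of_not_boxwiseConstant (hβ : ¬ BoxwiseConstant γ (betaOfMerged (betaMerged F ℰ ρ bV) β0 γ)) :
    SensitiveOnBoxes ((objects F ℰ ρ bV ℓ).EA k) γ :=
  sensitiveOnBoxes_of_representsA (representsA_objects F ℰ ρ bV ℓ β0 γ k) hβ

/-- **THE GUARD AT THE KERNEL OBJECTS, READ ON THE KERNELS**: the level functional is blind over the γ-boxes iff at any two histories of one box `]0,γ]^{k′+1}` ALL stored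
kernels coincide — `kernelA (extd v) j μ ν z = kernelA (extd v') j μ ν z` for every level `j`, directions `μ ν` and separation `z` (the background is the one point). [folklore] -/
theorem blindOnBoxes_objects_iff_kernels :
    BlindOnBoxes ((objects F ℰ ρ bV ℓ).EA k) γ ↔
      ∀ (k' : ℕ) (v v' : Fin (k' + 1) → ℝ), v ∈ Box γ k' → v' ∈ Box γ k' →
        ∀ (j : ℕ) (μ ν : Fin 4) (z : Fin 4 → ℤ), kernelA F ℰ ρ bV (extd v) j μ ν z = kernelA F ℰ ρ bV (extd v') j μ ν z := by
  constructor
  · intro h k' v v' hv hv' j μ ν z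
    exact congrFun (congrFun (h k' v v' hv hv') PUnit.unit) (j, μ, ν, z)
  · intro h k' v v' hv hv'
    funext U p
    obtain ⟨j, μ, ν, z⟩ := p
    exact h k' v v' hv hv' j μ ν z

/-- … so the guard there says: SOME box holds two histories at which SOME stored kernel entry differs. [folklore] -/
theorem sensitiveOnBoxes_objects_iff_kernels :
    SensitiveOnBoxes ((objects F ℰ ρ bV ℓ).EA k) γ ↔
      ∃ (k' : ℕ) (v v' : Fin (k' + 1) → ℝ), v ∈ Box γ k' ∧ v' ∈ Box γ k' ∧
        ∃ (j : ℕ) (μ ν : Fin 4) (z : Fin 4 → ℤ), kernelA F ℰ ρ bV (extd v) j μ ν z ≠ kernelA F ℰ ρ bV (extd v') j μ ν z := by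
  rw [sensitiveOnBoxes_iff_not_blindOnBoxes, blindOnBoxes_objects_iff_kernels]
  push Not
  rfl

end Generic

/-! ## §2 At the Stage-13 record: the guard at `U3OfKernels.objectsOfRecord₁₃` -/

section Record

variable {F : T4Family} {N : ℕ} [NeZero N] (θ : Stage13Params F N) (ℓ : U3Letters₁₁) (k : ℕ)

/-- **KERNELS OF RECORD BLIND TO THE BOX HISTORIES FORCE `betaOfRecord₁₃` BOXWISE CONSTANT** (`U3OfKernels.representsA_objectsOfRecord₁₃`, no hypothesis, +
`U3Guards.boxwiseConstant_of_representsA_blind`). [folklore] -/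
theorem boxwiseConstant_betaOfRecord₁₃_of_blindOnBoxes (h : BlindOnBoxes ((objectsOfRecord₁₃ F N θ ℓ).EA k) θ.γ) :
    BoxwiseConstant θ.γ (betaOfRecord₁₃ F N θ) :=
  boxwiseConstant_of_representsA_blind (representsA_objectsOfRecord₁₃ F N θ ℓ k) h

/-- **★★ THE OBJECTS OF RECORD PASS THE node-U3 GUARD AT EVERY TUPLE WHOSE β₁₃ IS NOT BOXWISE CONSTANT** — the conditional INHABITANT of the K3⁷ v2 skeleton's
`KeyedSensitive` conjunct at W1-19's objects (plan g80 (c)); β-non-degeneracy is the displayed hypothesis (NODE O's, not decidable here). [folklore] -/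
theorem sensitiveOnBoxes_objectsOfRecord₁₃_of_not_boxwiseConstant (hβ : ¬ BoxwiseConstant θ.γ (betaOfRecord₁₃ F N θ)) :
    SensitiveOnBoxes ((objectsOfRecord₁₃ F N θ ℓ).EA k) θ.γ :=
  sensitiveOnBoxes_of_representsA (representsA_objectsOfRecord₁₃ F N θ ℓ k) hβ

/-- The same at node U3's BUNDLE OF RECORD of the kernel objects (any run-length index; `U3Guards.sensitiveOnBoxes_u3OfRecord₁₃_iff`). [folklore] -/
theorem sensitiveOnBoxes_u3OfRecord₁₃_objectsOfRecord₁₃ (hβ : ¬ BoxwiseConstant θ.γ (betaOfRecord₁₃ F N θ)) :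
    SensitiveOnBoxes (u3OfRecord₁₃ θ (objectsOfRecord₁₃ F N θ ℓ) k).EA (u3OfRecord₁₃ θ (objectsOfRecord₁₃ F N θ ℓ) k).γ :=
  (sensitiveOnBoxes_u3OfRecord₁₃_iff θ _ k).mpr (sensitiveOnBoxes_objectsOfRecord₁₃_of_not_boxwiseConstant θ ℓ k hβ)

/-- **EVERY FIXED-CARRIER READING GIVES A LEVEL-FREE BUNDLE OF RECORD** (`U3Objects₁₁.ofFixed` — the kernel objects of record, the all-runs objects of a W1 reading
— puts the SAME carriers and functionals at every level index, so a run-length selector is idle; `rfl`). [folklore] -/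
theorem u3OfRecord₁₃_ofFixed_eq (C : Carriers) (EA : Functional C C.BgA) (EB : ℝ → Functional C C.BgB) (ℓ' : U3Letters₁₁) (k₁ k₂ : ℕ) :
    u3OfRecord₁₃ θ (U3Objects₁₁.ofFixed C EA EB ℓ') k₁ = u3OfRecord₁₃ θ (U3Objects₁₁.ofFixed C EA EB ℓ') k₂ := rfl

/-- In particular the bundle of record of the kernel objects of record does not depend on the run-length index (`rfl`). [folklore] -/
theorem u3OfRecord₁₃_objectsOfRecord₁₃_eq (k₁ k₂ : ℕ) :
    u3OfRecord₁₃ θ (objectsOfRecord₁₃ F N θ ℓ) k₁ = u3OfRecord₁₃ θ (objectsOfRecord₁₃ F N θ ℓ) k₂ := rfl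

end Record

/-! ## §3 Pin form: the `KeyedSensitive`-shaped conclusion at a Stage-13 reading pinned to the kernel objects of record -/

section Pinned

variable {N : ℕ} [NeZero N] (𝔯 : RateReading₁₃CoPH N) (ℓ : (F : T4Family) → Stage13HParams F N → U3Letters₁₁)
  (hpin : ∀ (F : T4Family) (θ : Stage13HParams F N) (hP : θ.Provisos₁₃CoPH F N) (g₀ : ℕ → ℝ) (os : List (ULoop F)),
    (𝔯.lit F θ hP g₀ os).u3 = objectsOfRecord₁₃ F N θ.toStage13Params (ℓ F θ))

include hpin in
/-- **★★ AT A READING PINNED TO THE KERNEL OBJECTS OF RECORD, EVERY RUN-LENGTH BUNDLE PASSES THE GUARD AT EVERY TUPLE WHOSE β₁₃ IS NOT BOXWISE CONSTANT** — the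
shape of the v2 skeleton's `KeyedSensitive 𝔯 ksel` conclusion `SensitiveOnBoxes (rrOfRecord 𝔯 ksel F θ hP g₀ os).u3.EA θ.γ`, for every selector value. [folklore] -/
theorem sensitiveOnBoxes_rateCarriers_of_kernels_pin (F : T4Family) (θ : Stage13HParams F N) (hP : θ.Provisos₁₃CoPH F N)
    (hβ : ¬ BoxwiseConstant θ.γ (betaOfRecord₁₃ F N θ.toStage13Params)) (g₀ : ℕ → ℝ) (os : List (ULoop F)) (k : ℕ) :
    SensitiveOnBoxes (rateCarriersOfRecord₁₃CoPH 𝔯 F θ hP g₀ os k).u3.EA θ.γ := by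
  show SensitiveOnBoxes (u3OfRecord₁₃ θ.toStage13Params (𝔯.lit F θ hP g₀ os).u3 k).EA θ.γ
  rw [hpin]
  exact sensitiveOnBoxes_objectsOfRecord₁₃_of_not_boxwiseConstant θ.toStage13Params (ℓ F θ) k hβ

include hpin in
/-- … and, conversely, if SOME run-length bundle of the pinned reading is blind over the record's boxes then β₁₃ is boxwise constant at that tuple. [folklore] -/
theorem boxwiseConstant_betaOfRecord₁₃_of_blind_kernels_pin (F : T4Family) (θ : Stage13HParams F N) (hP : θ.Provisos₁₃CoPH F N) (g₀ : ℕ → ℝ)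
    (os : List (ULoop F)) (k : ℕ) (h : BlindOnBoxes (rateCarriersOfRecord₁₃CoPH 𝔯 F θ hP g₀ os k).u3.EA θ.γ) :
    BoxwiseConstant θ.γ (betaOfRecord₁₃ F N θ.toStage13Params) := by
  change BlindOnBoxes (u3OfRecord₁₃ θ.toStage13Params (𝔯.lit F θ hP g₀ os).u3 k).EA θ.γ at h
  rw [hpin] at h
  exact boxwiseConstant_betaOfRecord₁₃_of_blindOnBoxes θ.toStage13Params (ℓ F θ) k h

end Pinned

end YMDAG.N18.U3GuardsAtKernels

end
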